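import Summits.HodgeConjecture.HodgeConjecture.Theorems.K2E5QuatAdelicLatticeDefs      -- ★ defs leaf #3j (p855463): `quatAdelicUnitsOne`, `quatRatLatticeOne`, `isClosed_quatAdelicUnitsOne`, `discreteTopology_∕countable_quatRatLatticeOne`
import Literature.NumberTheory.Automorphic.GLnAdelicLocallyCompact                      -- ★ `AdelicGroupData.locallyCompactSpace_generalLinearGroup_adeleRing`
import Literature.NumberTheory.Automorphic.GLnQuotientSubgroupHaar                      -- ★ `isHaarMeasure_count_of_discrete`
import HarnessLib

/-!
# K2 ∕ E5 «TamagawaUnitary», unit G (ZETA ∕ DESCENT) — helper `K2E5QuatUnitsOneTopology`: the standing TOPOLOGICAL∕HAAR instance facts of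
# `D^{(1)}_{h,𝔸} = {x ∈ (D_h ⊗ 𝔸)^× : ‖Nrd x‖_𝔸 = 1}` and of its lattice `Γ_h`, as THEOREMS (G3's instance binders, discharged)

Cell `hodgecm-mathlib` (Track B «K2-LIT»), floor 0, item h413 = `stmt-HodgeConjecture-24833`; unit G socket module `Cruxes/H413/Lines/K2_E5_TamagawaUnitary_Zeta.lean`
(K2E5-plan (g0)), socket G3 `sig_K2E5QuatZetaResidue` (Tate–Fujisaki for `D_h`) carries the instance binders `[LocallyCompactSpace ↥(quatAdelicUnitsOne L Ha)]`,
`[SecondCountableTopology ↥(quatAdelicUnitsOne L Ha)]`, `[T2Space ↥(quatAdelicUnitsOne L Ha)]` and the hypothesis `(count : Measure ↥(quatRatLatticeOne L Ha)).IsHaarMeasure`.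
PROOF lane, helper file (`--supports stmt-HodgeConjecture-24833 --as helper`), dealt BY NAME (DEALS E5 BATCH #8 (b), 2026-09-03T23:12:18Z); author K2E5-p19 (g0).  THEOREMS ONLY —
no `instance` (cell rule R3; consumers `haveI := …` them, ★ pattern `K2Lit.UnitaryDetFibration.isHaarMeasure_count_ratSU` ∕ ★ #3k `QuatUnitsPin`'s `haveI` block):

* `t2Space_quatAdelicUnits(One)`, `secondCountableTopology_quatAdelicUnits(One)`, `locallyCompactSpace_quatAdelicUnits(One)` — `(D_h ⊗ 𝔸)^×` is CLOSED in the locally compact,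
  second-countable, Hausdorff `GL₂(𝔸_L)` (★ #3d `isClosed_quatAdelicUnits`, ★ `AdelicGroupData.locallyCompactSpace_generalLinearGroup_adeleRing`, ★
  `secondCountableTopology_generalLinearGroup_adeleRing`, ★ `t2Space_adeleRing_of_numberField`), and `D^{(1)}_{h,𝔸}` is CLOSED in it (★ #3j `isClosed_quatAdelicUnitsOne`);
* `isHaarMeasure_count_quatRatLatticeOne` — the counting measure on the DISCRETE COUNTABLE lattice `Γ_h ≤ D^{(1)}_{h,𝔸}` (★ #3j `discreteTopology_quatRatLatticeOne`,
  `countable_quatRatLatticeOne`) is a Haar measure (★ `isHaarMeasure_count_of_discrete`), for the Borel structure induced from `GL₂(𝔸_L)` (G3's binders) — and, for consumers with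
  their own σ-algebra on `Γ_h`, `isHaarMeasure_count_quatRatLatticeOne'` under `[MeasurableSingletonClass]`.

HONEST LABEL: HC_CM is proved only modulo the 7 printed citations (2 remaining named inputs: hLiu418 = stmt-HodgeConjecture-24832,
h413 = stmt-HodgeConjecture-24833) until rung 0 closes; this helper closes no socket and changes no count.

## References
* [VignerasLNM800] M.-F. Vignéras, *Arithmétique des algèbres de quaternions*, LNM 800 (1980) — Ch. III §1 Thm. fondamental 1.4 (1) (`X_K` discrete in `X_A`; `X_A^×` locally compact).
* [WeilBNT1967] A. Weil, *Basic Number Theory* (1967) — Ch. IV §3–§4 (idèle topology, the module, `k_{A,1}`).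
* [PlatonovRapinchuk1994] V. Platonov, A. Rapinchuk, *Algebraic Groups and Number Theory* (1994) — §5.1 (adele groups are locally compact, rational points discrete).
-/

set_option autoImplicit false
set_option linter.dupNamespace false

noncomputable section

namespace Summit.HodgeConjecture.HodgeConjecture.Cruxes.H413.K2E5QuatUnitsOneTopology

open NumberField IsDedekindDomain MeasureTheory MeasureTheory.Measure TopologicalSpace
open Literature.NumberTheory.Automorphic
open Summit.HodgeConjecture.HodgeConjecture.Cruxes.H413.K2E5QuatAdelicMatrixModel
open Summit.HodgeConjecture.HodgeConjecture.Cruxes.H413.K2E5QuatAdelicLattice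
open scoped Matrix MatrixGroups

variable (L : Type) [Field L] [NumberField L] [IsCMField L] (Ha : Matrix (Fin 2) (Fin 2) L)

/-! ## §1 `(D_h ⊗ 𝔸)^×` and `D^{(1)}_{h,𝔸}`: Hausdorff, second countable, locally compact -/

omit [IsCMField L] in
/-- `GL₂(𝔸_L)` is Hausdorff (`𝔸_L` is, ★ `t2Space_adeleRing_of_numberField`; units carry the embedding topology). [cite: PlatonovRapinchuk1994, §5.1] -/
theorem t2Space_generalLinearGroup_adeleRing : T2Space (GL (Fin 2) (AdeleRing (𝓞 L) L)) := by
  haveI : T2Space (AdeleRing (𝓞 L) L) := t2Space_adeleRing_of_numberField L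
  infer_instance

/-- `(D_h ⊗ 𝔸)^×` is Hausdorff. [cite: PlatonovRapinchuk1994, §5.1] -/
theorem t2Space_quatAdelicUnits : T2Space ↥(quatAdelicUnits L Ha) := by
  haveI := t2Space_generalLinearGroup_adeleRing L
  infer_instance

/-- **`D^{(1)}_{h,𝔸}` is Hausdorff** (G3's binder `[T2Space ↥(quatAdelicUnitsOne L Ha)]`). [cite: WeilBNT1967, Ch. IV §4] -/
theorem t2Space_quatAdelicUnitsOne : T2Space ↥(quatAdelicUnitsOne L Ha) := by
  haveI := t2Space_quatAdelicUnits L Ha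
  infer_instance

/-- `(D_h ⊗ 𝔸)^×` is second countable (★ `secondCountableTopology_generalLinearGroup_adeleRing`). [cite: PlatonovRapinchuk1994, §5.1] -/
theorem secondCountableTopology_quatAdelicUnits : SecondCountableTopology ↥(quatAdelicUnits L Ha) := by
  haveI : SecondCountableTopology (GL (Fin 2) (AdeleRing (𝓞 L) L)) := secondCountableTopology_generalLinearGroup_adeleRing L (Fin 2)
  exact Topology.IsEmbedding.subtypeVal.secondCountableTopology

/-- **`D^{(1)}_{h,𝔸}` is second countable** (G3's binder `[SecondCountableTopology ↥(quatAdelicUnitsOne L Ha)]`). [cite: PlatonovRapinchuk1994, §5.1] -/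
theorem secondCountableTopology_quatAdelicUnitsOne : SecondCountableTopology ↥(quatAdelicUnitsOne L Ha) := by
  haveI := secondCountableTopology_quatAdelicUnits L Ha
  exact Topology.IsEmbedding.subtypeVal.secondCountableTopology

/-- `(D_h ⊗ 𝔸)^×` is locally compact: CLOSED (★ #3d `isClosed_quatAdelicUnits`) in the locally compact `GL₂(𝔸_L)` (★ `AdelicGroupData.locallyCompactSpace_generalLinearGroup_adeleRing`).
[cite: PlatonovRapinchuk1994, §5.1] [cite: VignerasLNM800, Ch. III §1] -/
theorem locallyCompactSpace_quatAdelicUnits : LocallyCompactSpace ↥(quatAdelicUnits L Ha) := by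
  haveI : LocallyCompactSpace (GL (Fin 2) (AdeleRing (𝓞 L) L)) := AdelicGroupData.locallyCompactSpace_generalLinearGroup_adeleRing L (Fin 2)
  exact (isClosed_quatAdelicUnits L Ha).isClosedEmbedding_subtypeVal.locallyCompactSpace

/-- **`D^{(1)}_{h,𝔸}` is locally compact** (G3's binder `[LocallyCompactSpace ↥(quatAdelicUnitsOne L Ha)]`): CLOSED in `(D_h ⊗ 𝔸)^×` (★ #3j `isClosed_quatAdelicUnitsOne`, the
preimage of `𝕀¹_L` under the continuous `Nrd`). [cite: WeilBNT1967, Ch. IV §4] [cite: VignerasLNM800, Ch. III §1 (X_{A,1})] -/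
theorem locallyCompactSpace_quatAdelicUnitsOne : LocallyCompactSpace ↥(quatAdelicUnitsOne L Ha) := by
  haveI := locallyCompactSpace_quatAdelicUnits L Ha
  exact (isClosed_quatAdelicUnitsOne L Ha).isClosedEmbedding_subtypeVal.locallyCompactSpace

/-! ## §2 The counting measure on the lattice `Γ_h ≤ D^{(1)}_{h,𝔸}` is a Haar measure -/

/-- **The counting measure on `Γ_h` is a Haar measure** for ANY σ-algebra on `Γ_h` measuring singletons: `Γ_h` is DISCRETE and COUNTABLE inside `D^{(1)}_{h,𝔸}`
(★ #3j `discreteTopology_quatRatLatticeOne`, `countable_quatRatLatticeOne`; ★ `isHaarMeasure_count_of_discrete`). [cite: VignerasLNM800, Ch. III §1 Thm. 1.4 (1)] [cite: WeilBNT1967, Ch. IV §4] -/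
theorem isHaarMeasure_count_quatRatLatticeOne' [MeasurableSpace ↥(quatRatLatticeOne L Ha)] [MeasurableSingletonClass ↥(quatRatLatticeOne L Ha)] :
    (count : Measure ↥(quatRatLatticeOne L Ha)).IsHaarMeasure := by
  haveI := discreteTopology_quatRatLatticeOne L Ha
  haveI := countable_quatRatLatticeOne L Ha
  exact isHaarMeasure_count_of_discrete

/-- **The counting measure on `Γ_h` is a Haar measure** for the Borel structure INDUCED FROM `GL₂(𝔸_L)` — exactly G3's hypothesis `(count : Measure ↥(quatRatLatticeOne L Ha)).IsHaarMeasure`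
under its binders `[MeasurableSpace (GL (Fin 2) (AdeleRing (𝓞 L) L))] [BorelSpace …]` (singletons of the Hausdorff `GL₂(𝔸_L)` are closed, hence measurable, and the subtype σ-algebra
inherits this). [cite: VignerasLNM800, Ch. III §1 Thm. 1.4 (1)] [cite: WeilBNT1967, Ch. IV §4] -/
theorem isHaarMeasure_count_quatRatLatticeOne [MeasurableSpace (GL (Fin 2) (AdeleRing (𝓞 L) L))] [BorelSpace (GL (Fin 2) (AdeleRing (𝓞 L) L))] :
    (count : Measure ↥(quatRatLatticeOne L Ha)).IsHaarMeasure := by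
  haveI := t2Space_generalLinearGroup_adeleRing L
  haveI : MeasurableSingletonClass (GL (Fin 2) (AdeleRing (𝓞 L) L)) := inferInstance
  exact isHaarMeasure_count_quatRatLatticeOne' L Ha

end Summit.HodgeConjecture.HodgeConjecture.Cruxes.H413.K2E5QuatUnitsOneTopology

end
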